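import Literature.GroupTheory.CombinatorialGroupTheory.AmalgamConjugationTheorem
import HarnessLib

/-!
# The conjugacy criterion for cyclically reduced elements of an amalgam (rotation + sliding form)

Topic `Literature/GroupTheory/CombinatorialGroupTheory`; theorems only, continuing
`AmalgamReducedWords` / `AmalgamConjugation` / `AmalgamConjugationTheorem` (letter lists in
Mathlib's `Monoid.PushoutI φ`; reduced = alternating factors, no letter in the amalgamated
subgroup; value `ℓπ[φ] l`; a reduced word of length `≥ 2` is cyclically reduced when its end letters
lie in different factors).  Magnus–Karrass–Solitar Thm. 4.6 (iii) / Lyndon–Schupp IV Thm. 2.8, in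
the form used by Dyer and Stebe to separate conjugacy classes in finite quotients
(J. L. Dyer, J. Austral. Math. Soc. (A) 29 (1980), Thm. 2 (3) p.38 and the equations (I), (II) p.38:
*"if `‖x‖ ≥ 2`, then `‖y‖ = ‖x‖` and `y ~_H x*` where `x*` is a cyclic permutation of `x`"*, and
*"`x ~_H y` if and only if there exists a finite sequence `h₀, h₁, …, h_k` of elements in `H` such that
`h_{i-1} u_i = v_i h_i'`… and `h_k = h₀`"*, after Stebe 1971 Lemma 8):

* `lprod_drop_mul_lprod_mul_inv` — `ℓπ (w.drop k) · ℓπ w · (ℓπ (w.drop k))⁻¹ = ℓπ (w.rotate k)`;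
* `exists_rotate_of_isConj` — **rotation form of the conjugation theorem**: if the values of two
  cyclically reduced words `x`, `y` of length `≥ 2` are conjugate in the amalgam, then
  `ℓπ y = (base c) · ℓπ (x.rotate k) · (base c)⁻¹` for some `c ∈ H`, `k < |x|` (from the tree's
  centralizer form `exists_eq_base_mul_drop_mul_zpow`); `isConj_iff_exists_rotate`;
  `map_fst_eq_rotate_of_isConj`, `length_eq_of_isConj` — hence `y` has the syllable pattern of a
  rotation of `x`, in particular the same length;
* `slide_cons_iff` — **Stebe's sliding criterion, one letter at a time**: for reduced words `a u` and
  `b v` with `a, b ∈ G i`, `ℓπ (b v) = (base c) · ℓπ (a u)` iff `φ c · a = b · φ h` and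
  `ℓπ v = (base h) · ℓπ u` for some `h ∈ H` (the first-letter lemma); `slide_nil_iff`;
* `slide_unique` — when `φ i(H)` is **malnormal** in `G i`, the pair `(c, h)` in
  `φ c · a = b · φ h` (`a ∉ φ i(H)`) is unique (Tang 1997, Lemma 3.2-type uniqueness).

## References

* W. Magnus, A. Karrass, D. Solitar, *Combinatorial Group Theory*, Interscience (1966), §4.2,
  Thm. 4.6. [MagnusKarrassSolitar1966]
* J. L. Dyer, *Separating conjugates in amalgamated free products and HNN extensions*, J. Austral.
  Math. Soc. Ser. A 29 (1980) 35–51, Thm. 2 and (I), (II) p.38. [Dyer1980]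
* R. C. Lyndon, P. E. Schupp, *Combinatorial Group Theory*, Springer (1977); Classics in
  Mathematics (2001), Ch. IV Thm. 2.8. [LyndonSchupp2001]
-/

namespace Literature.GroupTheory.CombinatorialGroupTheory

namespace Amalgam

open Monoid Monoid.PushoutI

variable {ι : Type*} {G : ι → Type*} [∀ i, Group (G i)] {H : Type*} [Group H]
  {φ : ∀ i, H →* G i}

/-- The value in `PushoutI φ` of a letter list. -/
local notation3 "ℓπ[" φ "] " l:max =>
  List.prod (List.map (fun x => Monoid.PushoutI.of (φ := φ) (Sigma.fst x) (Sigma.snd x)) l)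

/-! ### Rotation algebra -/

/-- `ℓπ (w.drop k) · ℓπ w · (ℓπ (w.drop k))⁻¹ = ℓπ (w.rotate k)` for `k ≤ |w|`: conjugating the value
of a word by the value of a terminal segment rotates the word.
[cite: MagnusKarrassSolitar1966, §4.2 Thm. 4.6] -/
theorem lprod_drop_mul_lprod_mul_inv (w : List (Σ i, G i)) {k : ℕ} (hk : k ≤ w.length) :
    ℓπ[φ] (w.drop k) * ℓπ[φ] w * (ℓπ[φ] (w.drop k))⁻¹ = ℓπ[φ] (w.rotate k) := by
  have hw : ℓπ[φ] w = ℓπ[φ] (w.take k) * ℓπ[φ] (w.drop k) := by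
    rw [← lprod_append, List.take_append_drop]
  rw [List.rotate_eq_drop_append_take hk, lprod_append, hw]
  group

/-- Powers of `W` conjugate `W` to itself: `(D · W ^ q) · W · (D · W ^ q)⁻¹ = D · W · D⁻¹`.
[cite: MagnusKarrassSolitar1966, §4.2 Thm. 4.6] -/
private theorem mul_zpow_conj_self {M : Type*} [Group M] (D W : M) (q : ℤ) :
    D * W ^ q * W * (D * W ^ q)⁻¹ = D * W * D⁻¹ := by
  have h : W ^ q * W = W * W ^ q := by
    rw [← zpow_add_one, ← zpow_one_add, add_comm]
  calc D * W ^ q * W * (D * W ^ q)⁻¹ = D * (W ^ q * W) * (W ^ q)⁻¹ * D⁻¹ := by group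
    _ = D * (W * W ^ q) * (W ^ q)⁻¹ * D⁻¹ := by rw [h]
    _ = D * W * D⁻¹ := by group

/-! ### The conjugation theorem, rotation form -/

/-- **Conjugation theorem (MKS 4.6 (iii)), rotation form.**  Let `x`, `y` be reduced words of length
`≥ 2` whose end letters lie in different factors (cyclically reduced).  If their values are conjugate
in the amalgam, then `ℓπ y = (base c) · ℓπ (x.rotate k) · (base c)⁻¹` for some `c ∈ H` and
`k < |x|` (Dyer: *"`y ~_H x*` where `x*` is a cyclic permutation of `x`"*).
[cite: Dyer1980, Thm. 2 (3) p.38] -/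
theorem exists_rotate_of_isConj (hφ : ∀ i, Function.Injective (φ i))
    {x y : List (Σ i, G i)} (hxc : x.IsChain fun a b => a.1 ≠ b.1)
    (hxr : ∀ z ∈ x, z.2 ∉ (φ z.1).range) (hx2 : 2 ≤ x.length)
    (hxcr : ∀ a ∈ x.getLast?, ∀ b ∈ x.head?, a.1 ≠ b.1)
    (hyc : y.IsChain fun a b => a.1 ≠ b.1) (hyr : ∀ z ∈ y, z.2 ∉ (φ z.1).range)
    (hycr : ∀ a ∈ y.getLast?, ∀ b ∈ y.head?, a.1 ≠ b.1)
    (h : IsConj (ℓπ[φ] x) (ℓπ[φ] y)) :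
    ∃ (c : H) (k : ℕ), k < x.length ∧ ℓπ[φ] y = base φ c * ℓπ[φ] (x.rotate k) * (base φ c)⁻¹ := by
  obtain ⟨g, hg⟩ := isConj_iff.mp h
  -- write the conjugator as `base c₀ · ℓπ hl` with `hl` reduced
  obtain ⟨c₀, hl, hlc, hlr, rfl⟩ := exists_reduced_eq hφ g
  -- `ℓπ hl · X · (ℓπ hl)⁻¹ = base c₀⁻¹ · Y · base c₀` is cyclically reduced
  have hconj : ℓπ[φ] hl * ℓπ[φ] x * (ℓπ[φ] hl)⁻¹ =
      base φ c₀⁻¹ * ℓπ[φ] y * (base φ c₀⁻¹)⁻¹ := by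
    rw [← hg, map_inv, inv_inv]; group
  have hY := cr_base_conj (cr_of_word hφ hyc hyr
    (Or.inr hycr)) c₀⁻¹
  rw [← hconj] at hY
  obtain ⟨c, k, q, hk, e⟩ :=
    exists_eq_base_mul_drop_mul_zpow hl.length x hl hx2 hxc hxr hxcr rfl hlc hlr hY
  refine ⟨c₀ * c, k, hk, ?_⟩
  have e2 : ℓπ[φ] hl * ℓπ[φ] x * (ℓπ[φ] hl)⁻¹ =
      base φ c * ℓπ[φ] (x.rotate k) * (base φ c)⁻¹ := by
    have step : ℓπ[φ] hl * ℓπ[φ] x * (ℓπ[φ] hl)⁻¹ =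
        base φ c * (ℓπ[φ] (x.drop k) * ℓπ[φ] x ^ q * ℓπ[φ] x *
          (ℓπ[φ] (x.drop k) * ℓπ[φ] x ^ q)⁻¹) * (base φ c)⁻¹ := by
      rw [e]; group
    rw [step, mul_zpow_conj_self, lprod_drop_mul_lprod_mul_inv x hk.le]
  calc ℓπ[φ] y = base φ c₀ * (ℓπ[φ] hl * ℓπ[φ] x * (ℓπ[φ] hl)⁻¹) * (base φ c₀)⁻¹ := by
        rw [← hg]; group
    _ = base φ (c₀ * c) * ℓπ[φ] (x.rotate k) * (base φ (c₀ * c))⁻¹ := by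
        rw [e2, map_mul]; group

/-- **Conjugacy criterion for cyclically reduced words of length `≥ 2`**: the values of `x` and `y`
are conjugate in the amalgam iff `ℓπ y` is a base-conjugate of the value of a rotation of `x`.
[cite: Dyer1980, Thm. 2 (3) p.38] -/
theorem isConj_iff_exists_rotate (hφ : ∀ i, Function.Injective (φ i))
    {x y : List (Σ i, G i)} (hxc : x.IsChain fun a b => a.1 ≠ b.1)
    (hxr : ∀ z ∈ x, z.2 ∉ (φ z.1).range) (hx2 : 2 ≤ x.length)
    (hxcr : ∀ a ∈ x.getLast?, ∀ b ∈ x.head?, a.1 ≠ b.1)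
    (hyc : y.IsChain fun a b => a.1 ≠ b.1) (hyr : ∀ z ∈ y, z.2 ∉ (φ z.1).range)
    (hycr : ∀ a ∈ y.getLast?, ∀ b ∈ y.head?, a.1 ≠ b.1) :
    IsConj (ℓπ[φ] x) (ℓπ[φ] y) ↔
      ∃ (c : H) (k : ℕ), k < x.length ∧
        ℓπ[φ] y = base φ c * ℓπ[φ] (x.rotate k) * (base φ c)⁻¹ := by
  refine ⟨exists_rotate_of_isConj hφ hxc hxr hx2 hxcr hyc hyr hycr, ?_⟩
  rintro ⟨c, k, hk, e⟩
  rw [e, ← lprod_drop_mul_lprod_mul_inv x hk.le]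
  refine isConj_iff.mpr ⟨base φ c * ℓπ[φ] (x.drop k), ?_⟩
  group

/-! ### Syllable patterns of conjugate cyclically reduced words -/

omit [∀ i, Group (G i)] in
/-- A rotation of an alternating word whose end letters lie in different factors alternates.
[cite: MagnusKarrassSolitar1966, §4.2 Thm. 4.6] -/
theorem isChain_rotate {w : List (Σ i, G i)} (hc : w.IsChain fun a b => a.1 ≠ b.1)
    (hcr : ∀ a ∈ w.getLast?, ∀ b ∈ w.head?, a.1 ≠ b.1) (k : ℕ) :
    (w.rotate k).IsChain fun a b => a.1 ≠ b.1 := by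
  rcases Nat.eq_zero_or_pos w.length with h0 | hn
  · rw [List.length_eq_zero_iff.mp h0, List.rotate_nil]; exact List.IsChain.nil
  rw [← List.rotate_mod, List.rotate_eq_drop_append_take (Nat.mod_lt _ hn).le,
    List.isChain_append]
  refine ⟨hc.drop _, hc.take _, ?_⟩
  intro x hx y hy
  have hx' : x ∈ w.getLast? := by
    rw [List.getLast?_drop] at hx
    split_ifs at hx with hle
    · exact absurd hx (by simp)
    · exact hx
  have hy' : y ∈ w.head? := by
    rw [List.head?_take] at hy
    split_ifs at hy with h0
    · exact absurd hy (by simp)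
    · exact hy
  exact hcr x hx' y hy'

/-- **Conjugate cyclically reduced words of length `≥ 2` have rotation-related syllable patterns**:
the sequence of factors of `y` is that of some rotation of `x`.
[cite: Dyer1980, Thm. 2 (3) p.38] -/
theorem map_fst_eq_rotate_of_isConj (hφ : ∀ i, Function.Injective (φ i))
    {x y : List (Σ i, G i)} (hxc : x.IsChain fun a b => a.1 ≠ b.1)
    (hxr : ∀ z ∈ x, z.2 ∉ (φ z.1).range) (hx2 : 2 ≤ x.length)
    (hxcr : ∀ a ∈ x.getLast?, ∀ b ∈ x.head?, a.1 ≠ b.1)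
    (hyc : y.IsChain fun a b => a.1 ≠ b.1) (hyr : ∀ z ∈ y, z.2 ∉ (φ z.1).range)
    (hy2 : 2 ≤ y.length) (hycr : ∀ a ∈ y.getLast?, ∀ b ∈ y.head?, a.1 ≠ b.1)
    (h : IsConj (ℓπ[φ] x) (ℓπ[φ] y)) :
    ∃ k : ℕ, k < x.length ∧ y.map Sigma.fst = (x.rotate k).map Sigma.fst := by
  obtain ⟨c, k, hk, e⟩ := exists_rotate_of_isConj hφ hxc hxr hx2 hxcr hyc hyr hycr h
  refine ⟨k, hk, ?_⟩
  -- move `(base c)⁻¹` into the last letter of `y`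
  obtain ⟨a, y₁, rfl⟩ := List.exists_cons_of_ne_nil (l := y) (by rintro rfl; simp at hy2)
  have hy₁ : y₁ ≠ [] := by rintro rfl; simp at hy2
  obtain ⟨y', b, rfl⟩ : ∃ y' b, y₁ = y' ++ [b] :=
    ⟨y₁.dropLast, y₁.getLast hy₁, (List.dropLast_append_getLast hy₁).symm⟩
  have e1 : ℓπ[φ] (a :: (y' ++ [⟨b.1, b.2 * φ b.1 c⟩])) = base φ c * ℓπ[φ] (x.rotate k) := by
    rw [← List.cons_append, ← lprod_concat_mul_base, List.cons_append, e]; group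
  have hpat := map_fst_eq_of_lprod_eq hφ (l := a :: (y' ++ [⟨b.1, b.2 * φ b.1 c⟩]))
    (l' := x.rotate k) ?_ ?_ (isChain_rotate hxc hxcr k) ?_ c e1
  · simpa using hpat
  · rw [← List.cons_append]
    exact isChain_of_map_fst_eq (by simp) hyc
  · intro z hz
    rw [List.mem_cons, List.mem_append, List.mem_singleton] at hz
    rcases hz with rfl | hz | rfl
    · exact hyr _ List.mem_cons_self
    · exact hyr z (List.mem_cons_of_mem _ (List.mem_append_left _ hz))
    · simpa using mul_not_mem_range (hyr b (by simp)) 1 c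
  · intro z hz
    exact hxr z (List.mem_rotate.mp hz)

/-- **Conjugate cyclically reduced words of length `≥ 2` have the same length** (Dyer:
*"`‖y‖ = ‖x‖`"*). [cite: Dyer1980, Thm. 2 (3) p.38] -/
theorem length_eq_of_isConj (hφ : ∀ i, Function.Injective (φ i))
    {x y : List (Σ i, G i)} (hxc : x.IsChain fun a b => a.1 ≠ b.1)
    (hxr : ∀ z ∈ x, z.2 ∉ (φ z.1).range) (hx2 : 2 ≤ x.length)
    (hxcr : ∀ a ∈ x.getLast?, ∀ b ∈ x.head?, a.1 ≠ b.1)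
    (hyc : y.IsChain fun a b => a.1 ≠ b.1) (hyr : ∀ z ∈ y, z.2 ∉ (φ z.1).range)
    (hy2 : 2 ≤ y.length) (hycr : ∀ a ∈ y.getLast?, ∀ b ∈ y.head?, a.1 ≠ b.1)
    (h : IsConj (ℓπ[φ] x) (ℓπ[φ] y)) : y.length = x.length := by
  obtain ⟨k, -, e⟩ := map_fst_eq_rotate_of_isConj hφ hxc hxr hx2 hxcr hyc hyr hy2 hycr h
  simpa using congrArg List.length e

/-! ### Stebe's sliding criterion -/

/-- **Sliding, empty words**: `ℓπ [] = (base c) · ℓπ []` iff `c = 1` (for injective `φ`).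
[cite: Dyer1980, (I)–(II) p.38] -/
theorem slide_nil_iff (hφ : ∀ i, Function.Injective (φ i)) (c : H) :
    ℓπ[φ] ([] : List (Σ i, G i)) = base φ c * ℓπ[φ] ([] : List (Σ i, G i)) ↔ c = 1 := by
  simp only [List.map_nil, List.prod_nil, mul_one]
  constructor
  · intro h
    exact base_injective hφ (by rw [map_one]; exact h.symm)
  · rintro rfl; rw [map_one]

/-- **Stebe's sliding criterion, one letter** (Dyer's equations (I)): for reduced words `a u` and
`b v` with `a, b ∈ G i` and `c ∈ H`, `ℓπ (b v) = (base c) · ℓπ (a u)` iff there is `h ∈ H` with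
`φ c · a = b · φ h` and `ℓπ v = (base h) · ℓπ u` — the first-letter lemma, iterated by the user
down the two words. [cite: Dyer1980, (I)–(II) p.38] -/
theorem slide_cons_iff (hφ : ∀ i, Function.Injective (φ i)) {i : ι} {a b : G i}
    {u v : List (Σ i, G i)}
    (huc : (⟨i, a⟩ :: u : List _).IsChain fun a b => a.1 ≠ b.1)
    (hur : ∀ z ∈ (⟨i, a⟩ :: u : List (Σ i, G i)), z.2 ∉ (φ z.1).range)
    (hvc : (⟨i, b⟩ :: v : List _).IsChain fun a b => a.1 ≠ b.1)
    (hvr : ∀ z ∈ (⟨i, b⟩ :: v : List (Σ i, G i)), z.2 ∉ (φ z.1).range) (c : H) :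
    ℓπ[φ] (⟨i, b⟩ :: v) = base φ c * ℓπ[φ] (⟨i, a⟩ :: u) ↔
      ∃ h : H, φ i c * a = b * φ i h ∧ ℓπ[φ] v = base φ h * ℓπ[φ] u := by
  constructor
  · intro e
    -- first-letter lemma: `(φ c · a)⁻¹ · b ∈ φ i(H)`
    obtain ⟨h', hh'⟩ := inv_mul_mem_range_of_lprod_cons_eq hφ hvc hvr huc hur c e
    refine ⟨h'⁻¹, ?_, ?_⟩
    · rw [map_inv, hh']; group
    · -- cancel the first letters
      have e1 : of (φ := φ) i b * ℓπ[φ] v = of i b * (base φ h'⁻¹ * ℓπ[φ] u) := by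
        have hb : of (φ := φ) i (φ i c * a) = of i b * base φ h'⁻¹ := by
          have : φ i c * a = b * φ i h'⁻¹ := by rw [map_inv, hh']; group
          rw [this, map_mul, of_apply_eq_base]
        rw [lprod_cons] at e
        rw [base_mul_lprod_cons, lprod_cons] at e
        dsimp only at e
        rw [e, hb, mul_assoc]
      exact mul_left_cancel e1
  · rintro ⟨h, hh, e⟩
    rw [base_mul_lprod_cons, lprod_cons, lprod_cons]
    dsimp only
    rw [hh, e, map_mul, of_apply_eq_base, mul_assoc]

/-- **Uniqueness of the sliding pair under malnormality** (Tang 1997, Lemma 3.2-type): if `φ i(H)`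
is malnormal in `G i` and `a ∉ φ i(H)`, then the pair `(c, h)` with `φ c · a = b · φ h` is unique.
[cite: Dyer1980, (I)–(II) p.38] -/
theorem slide_unique (hφ : ∀ i, Function.Injective (φ i)) {i : ι}
    (hmal : ∀ g : G i, g ∉ (φ i).range → ∀ c : H, g * φ i c * g⁻¹ ∈ (φ i).range → c = 1)
    {a b : G i} (ha : a ∉ (φ i).range) {c₁ c₂ h₁ h₂ : H}
    (e₁ : φ i c₁ * a = b * φ i h₁) (e₂ : φ i c₂ * a = b * φ i h₂) : c₁ = c₂ ∧ h₁ = h₂ := by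
  -- `b = φ c₁ · a · φ h₁⁻¹` is off the base group
  have hb : b ∉ (φ i).range := by
    have : b = φ i c₁ * a * φ i h₁⁻¹ := by rw [e₁, map_inv, mul_inv_cancel_right]
    rw [this]
    exact mul_not_mem_range ha c₁ h₁⁻¹
  -- `b⁻¹ · φ(c₂ c₁⁻¹) · b = φ(h₂ h₁⁻¹)`
  have key : b⁻¹ * φ i (c₂ * c₁⁻¹) * b⁻¹⁻¹ ∈ (φ i).range := by
    refine ⟨h₂ * h₁⁻¹, ?_⟩
    rw [inv_inv, map_mul, map_inv, map_mul, map_inv]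
    have ea : a = (φ i c₁)⁻¹ * (b * φ i h₁) := by rw [← e₁]; group
    have e3 : φ i c₂ * ((φ i c₁)⁻¹ * (b * φ i h₁)) = b * φ i h₂ := by rw [← ea]; exact e₂
    calc φ i h₂ * (φ i h₁)⁻¹ = b⁻¹ * (b * φ i h₂) * (φ i h₁)⁻¹ := by group
      _ = b⁻¹ * (φ i c₂ * ((φ i c₁)⁻¹ * (b * φ i h₁))) * (φ i h₁)⁻¹ := by rw [e3]
      _ = b⁻¹ * (φ i c₂ * (φ i c₁)⁻¹) * b := by group
  have hc : c₂ * c₁⁻¹ = 1 := hmal b⁻¹ (inv_not_mem_range hb) _ key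
  have hc' : c₁ = c₂ := by rw [mul_inv_eq_one] at hc; exact hc.symm
  refine ⟨hc', hφ i ?_⟩
  have := e₂
  rw [← hc', e₁] at this
  exact mul_left_cancel this

end Amalgam

end Literature.GroupTheory.CombinatorialGroupTheory
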